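import Literature.Probability.LatticeModels.AizenmanWickSplice
import HarnessLib

/-!
# Truncated multi-spin correlations in a field are dominated by free pair correlations (random currents)

Topic `Literature/Probability/LatticeModels`, namespace `Literature.Probability.LatticeModels.Current`.
Edge couplings `K ≥ 0` on a finite simple graph `G` with a distinguished *ghost* vertex `g`
(Griffiths' trick: the couplings `K_{vg}` of the edges at `g` are arbitrary nonnegative fields / a `+`
boundary condition); zero-field spin expectations of the model on `G` are the current ratios
`⟨σ_S⟩ = Z_K[S]/Z_K[∅]` (`WeightedCurrentsDictionary.lean`), and the expectations **with** the field are
`⟨σ_S⟩_h = ⟨σ_{S*}⟩` with the starred source set `S* = S` (`|S|` even) or `S ∪ {g}` (`|S|` odd) —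
here `Current.gstar g S`. With `Z'[·] = ecurrentSumIn (offGraph G {g}) K ·` the current sums of the
graph with the ghost edges deleted (the model WITHOUT the field) we prove, for `c ∉ A`, `g ∉ A`, `c ≠ g`:

* `Current.ghost_truncation_bound` (in `ℝ≥0∞`, product form):
  `Z'[∅]·Z[(cA)*]·Z[∅] ≤ Z'[∅]·Z[A*]·Z[{c,g}] + Z[∅]·∑_{j∈A} Z[(A∖j)*]·Z'[{c,j}]`;
* `Current.ghost_truncation_bound_ratio` (real form): with `W(S) = Z[S]/Z[∅]`, `W'(S) = Z'[S]/Z'[∅]`,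
  `W((cA)*) - W({c,g}) W(A*) ≤ ∑_{j ∈ A} W((A∖j)*) · W'({c,j})`,
  i.e. **`⟨σ_cσ_A⟩_h - ⟨σ_c⟩_h⟨σ_A⟩_h ≤ ∑_{j ∈ A} ⟨σ_{A∖j}⟩_h · ⟨σ_cσ_j⟩_{h = 0}`** for the
  ferromagnetic Ising model with nonnegative (site-dependent) fields `h`.

For `A = {j}` this is the classical `⟨σ_c;σ_j⟩_h ≤ ⟨σ_cσ_j⟩_{h=0}` (GHS integrated in the field;
Griffiths–Hurst–Sherman 1970, Lebowitz 1974; Aizenman–Fernández 1986, (4.22)); the general case is the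
input replacing the GHS inequality in Chelkak–Hongler–Izyurov's Lemma 2.26 (boundary decorrelation) for an
arbitrary number of spins (`PlanarIsingBoundaryDecorrelation.lean`).

## Proof (random currents with a ghost; every step is an existing tree identity)

1. `Z[A*]Z[{c,g}] = ∑_{∂n₁=(cA)*, ∂n₂=∅} w w 𝟙[g ∈ C(c)]` (switching the pair `{c,g}`,
   `Current.tsum_epairWeight_switch_pair`), so `Z[(cA)*]Z[∅] - Z[A*]Z[{c,g}] = ∑ w w 𝟙[g ∉ C(c)] =: N`
   (Aizenman–Duminil-Copin 2021, (3.7): `⟨σ_A⟩⟨σ_B⟩/⟨σ_Aσ_B⟩ = P^{A∆B,∅}[𝓕_B]`).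
2. On `{g ∉ C(c)}` the cluster of `c` in `n₁+n₂` contains an even number of sources
   (`Current.even_card_sources_filter_reachable`), hence some `j ∈ A`: `N ≤ ∑_j N_j`,
   `N_j = ∑ w w 𝟙[g ∉ C(c)] 𝟙[j ∈ C(c)]`.
3. Switching the pair `{c,j}`: `N_j = ∑_{∂n₁=(A∖j)*, ∂n₂={c,j}} w w 𝟙[g ∉ C_{n₁+n₂}(c)]
   ≤ Z[(A∖j)*] · G♭(c,j)` with the ghost-avoiding sum `G♭(c,j) = ∑_{∂n={c,j}, g ∉ C_n(c)} w(n)`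
   (`Current.gflat`; `C_{n₂}(c) ⊆ C_{n₁+n₂}(c)`).
4. `G♭(c,j) · Z'[∅] ≤ Z'[{c,j}] · Z[∅]` (`Current.gflat_mul_le`): conditioning on the cluster `C` of `c`
   (`Current.cmass`) and Griffiths' monotonicity under deletion of the (far-away) ghost edges,
   `Current.cmass_empty_mul_le` of `AizenmanWickSplice.lean` (supermodularity of `log Z[∅]`, GKS II) — the
   random-current form of Aizenman–Fernández's `K(x,y) ≤ ⟨σₓσ_y⟩_{h=0}`.

## References

* M. Aizenman, R. Fernández, J. Stat. Phys. 44 (1986) 393–454, Prop. 4.7, (4.22) [AizenmanFernandezJSP1986].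
* M. Aizenman, Comm. Math. Phys. 86 (1982) 1–48, §5, Lemmas 9.2–9.3 [AizenmanCMP1982].
* M. Aizenman, H. Duminil-Copin, Ann. of Math. 194 (2021), Lemma 3.3, (3.7) [AizenmanDuminilCopinAnnals2021].
* R. B. Griffiths, C. A. Hurst, S. Sherman, J. Math. Phys. 11 (1970) 790; J. L. Lebowitz, Comm. Math.
  Phys. 35 (1974) 87 (the case `|A| = 1`).
* D. Chelkak, C. Hongler, K. Izyurov, Ann. of Math. 181 (2015), §2.10, Lemma 2.26 (the application)
  [ChelkakHonglerIzyurovAnnals2015].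
-/

noncomputable section

open Finset
open scoped symmDiff ENNReal

namespace Literature.Probability.LatticeModels

variable {V : Type*} [Fintype V] [DecidableEq V] {G : SimpleGraph V} [DecidableRel G.Adj]

namespace Current

/-! ### Starred source sets -/

/-- The starred source set of Griffiths' ghost trick: `S* = S` if `#S` is even and `S ∆ {g}` (i.e.
`S ∪ {g}` for `g ∉ S`) otherwise — the source set of the current representation of `⟨σ_S⟩` in a field
(Duminil-Copin–Tassion 2016, eq. (2.2)). [cite: DuminilCopinTassionCMP2016, §2.3, eq. (2.2) (arXiv:1502.03050 numbering)] -/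
def gstar (g : V) (S : Finset V) : Finset V := if Even #S then S else S ∆ {g}

omit [Fintype V] in
/-- Inserting a new point `c` toggles the parity: `(cA)* = A* ∆ {c} ∆ {g}`. [folklore] -/
theorem gstar_insert {g c : V} {A : Finset V} (hc : c ∉ A) :
    gstar g (insert c A) = gstar g A ∆ ({c} ∆ {g}) := by
  unfold gstar
  rw [card_insert_of_notMem hc]
  by_cases h : Even #A
  · have h' : ¬Even (#A + 1) := fun h1 => by
      rcases h with ⟨k, hk⟩; rcases h1 with ⟨l, hl⟩; omega
    rw [if_pos h, if_neg h']
    ext v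
    simp only [mem_symmDiff, mem_insert, mem_singleton]
    by_cases hvc : v = c
    · subst hvc; simp [hc]
    · simp [hvc]
  · have h' : Even (#A + 1) := by
      rcases Nat.even_or_odd #A with h1 | ⟨k, hk⟩
      · exact absurd h1 h
      · exact ⟨k + 1, by omega⟩
    rw [if_neg h, if_pos h']
    ext v
    simp only [mem_symmDiff, mem_insert, mem_singleton]
    by_cases hvc : v = c
    · subst hvc; simp [hc]; tauto
    · simp [hvc]
      tauto

omit [Fintype V] in
/-- Exchanging a point: for `j ∈ A`, `c ∉ A`, `(cA)* = (A ∖ j)* ∆ {c} ∆ {j}`. [folklore] -/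
theorem gstar_insert_erase {g c j : V} {A : Finset V} (hc : c ∉ A) (hj : j ∈ A) :
    gstar g (insert c A) = gstar g (A.erase j) ∆ ({c} ∆ {j}) := by
  have hcj : c ≠ j := fun h => hc (h ▸ hj)
  unfold gstar
  rw [card_insert_of_notMem hc, card_erase_of_mem hj]
  have hA : 1 ≤ #A := card_pos.2 ⟨j, hj⟩
  have hpar : Even (#A + 1) ↔ Even (#A - 1) := by
    constructor
    · rintro ⟨k, hk⟩; exact ⟨k - 1, by omega⟩
    · rintro ⟨k, hk⟩; exact ⟨k + 1, by omega⟩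
  by_cases h : Even (#A + 1)
  · rw [if_pos h, if_pos (hpar.1 h)]
    ext v
    simp only [mem_symmDiff, mem_insert, mem_singleton, mem_erase]
    by_cases hvc : v = c
    · subst hvc; simp [hc, hcj]
    · by_cases hvj : v = j
      · subst hvj; simp [hj, hvc]
      · simp [hvc, hvj]
  · rw [if_neg h, if_neg (fun h' => h (hpar.2 h'))]
    ext v
    simp only [mem_symmDiff, mem_insert, mem_singleton, mem_erase]
    by_cases hvc : v = c
    · subst hvc; simp [hc, hcj]
    · by_cases hvj : v = j
      · subst hvj; simp [hj, hvc]
      · simp [hvc, hvj]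

omit [Fintype V] in
/-- `c ∈ (cA)*` (for `c ≠ g`). [folklore] -/
theorem mem_gstar_insert_self {g c : V} (hcg : c ≠ g) (A : Finset V) : c ∈ gstar g (insert c A) := by
  unfold gstar
  split_ifs
  · exact mem_insert_self c A
  · rw [mem_symmDiff]; exact Or.inl ⟨mem_insert_self c A, by simpa using hcg⟩

omit [Fintype V] in
/-- A point of `(cA)*` other than `c` and `g` lies in `A`. [folklore] -/
theorem mem_of_mem_gstar_insert {g c v : V} {A : Finset V} (hv : v ∈ gstar g (insert c A))
    (hvc : v ≠ c) (hvg : v ≠ g) : v ∈ A := by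
  unfold gstar at hv
  split_ifs at hv
  · exact (mem_insert.1 hv).resolve_left hvc
  · rw [mem_symmDiff, mem_singleton] at hv
    rcases hv with ⟨h, -⟩ | ⟨h, -⟩
    · exact (mem_insert.1 h).resolve_left hvc
    · exact absurd h hvg

/-! ### The ghost-avoiding pair sum `G♭(c,j)` and Griffiths' monotonicity -/

variable {K : G.edgeFinset → ℝ}

/-- **The ghost-avoiding two-point current sum** `G♭(c,j) = ∑_{∂n = {c} ∆ {j}} w_K(n) 𝟙[g ∉ C_n(c)]`
(currents with sources `{c,j}` whose cluster of `c` avoids the ghost; the random-current counterpart of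
Aizenman–Fernández's kernel `K(x,y)`, cf. `gAvoidZ` of `GhostAvoidingCurrents.lean` in the
locally-finite formalism). [cite: AizenmanFernandezJSP1986, §4.3, Definition 4.5, eq. (4.16), p. 422] -/
def gflat (K : G.edgeFinset → ℝ) (g c j : V) : ℝ≥0∞ :=
  ∑' n : Current G, if n.sources = {c} ∆ {j} ∧ g ∉ n.cluster c then n.eweight K else 0

/-- Resolving `G♭` by the cluster of `c`: `G♭(c,j) = ∑_{C ∌ g} M_∅[{c,j}](C)`. [cite: AizenmanCMP1982, §5 (conditioning on the cluster)] -/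
theorem gflat_eq_sum_cmass (K : G.edgeFinset → ℝ) (g c j : V) :
    gflat K g c j = ∑ C : Finset V, if g ∉ C then cmass K ∅ ({c} ∆ {j}) c C else 0 := by
  have h := tsum_mul_apply_cluster_eq_sum
    (fun n : Current G => if n.sources = {c} ∆ {j} then n.eweight K else 0)
    (fun C => if g ∉ C then 1 else 0) c
  have hL : gflat K g c j = ∑' n : Current G,
      (if n.sources = {c} ∆ {j} then n.eweight K else 0) * (if g ∉ n.cluster c then 1 else 0) := by
    unfold gflat
    refine tsum_congr fun n => ?_
    by_cases h1 : n.sources = {c} ∆ {j} <;> by_cases h2 : g ∉ n.cluster c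
    · rw [if_pos ⟨h1, h2⟩, if_pos h1, if_pos h2, mul_one]
    · rw [if_neg (fun h => h2 h.2), if_neg h2, mul_zero]
    · rw [if_neg (fun h => h1 h.1), if_neg h1, zero_mul]
    · rw [if_neg (fun h => h1 h.1), if_neg h1, zero_mul]
  rw [hL, h]
  refine Finset.sum_congr rfl fun C _ => ?_
  by_cases hg : g ∉ C
  · rw [if_pos hg, if_pos hg, mul_one]
    unfold cmass
    refine tsum_congr fun n => ?_
    by_cases h1 : n.sources = {c} ∆ {j} <;> by_cases h2 : n.cluster c = C
    · rw [if_pos h1, if_pos h2, if_pos ⟨isSupp_offGraph_empty n, h1, h2⟩, mul_one]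
    · rw [if_pos h1, if_neg h2, mul_zero,
        if_neg (show ¬(IsSupp (offGraph G ∅) n ∧ n.sources = {c} ∆ {j} ∧ n.cluster c = C) from
          fun h => h2 h.2.2)]
    · rw [if_neg h1, zero_mul,
        if_neg (show ¬(IsSupp (offGraph G ∅) n ∧ n.sources = {c} ∆ {j} ∧ n.cluster c = C) from
          fun h => h1 h.2.1)]
    · rw [if_neg h1, zero_mul,
        if_neg (show ¬(IsSupp (offGraph G ∅) n ∧ n.sources = {c} ∆ {j} ∧ n.cluster c = C) from
          fun h => h1 h.2.1)]
  · rw [if_neg hg, if_neg hg, mul_zero]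

/-- **`G♭(c,j) · Z'[∅] ≤ Z'[{c,j}] · Z[∅]`**, `Z'` the current sums with the ghost edges deleted — the
random-current form of Aizenman–Fernández's `K(x,y) ≤ ⟨σₓσ_y⟩_{h=0}` ((4.22), right half): conditioning
on the cluster of `c` (which avoids `g`) and Griffiths' monotonicity `cmass_empty_mul_le` (GKS II through the
supermodularity of `log Z[∅]`, `CurrentPartitionMonotone.lean`). [cite: AizenmanFernandezJSP1986, §4.3, Proposition 4.7, eq. (4.22), p. 423] -/
theorem gflat_mul_le (hK : ∀ e, 0 ≤ K e) (g c j : V) :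
    gflat K g c j * ecurrentSumIn (offGraph G {g}) K ∅ ≤
      ecurrentSumIn (offGraph G {g}) K ({c} ∆ {j}) * ecurrentSum K ∅ := by
  rw [gflat_eq_sum_cmass, Finset.sum_mul, ← sum_cmass_eq K {g} ({c} ∆ {j}) c, Finset.sum_mul]
  refine Finset.sum_le_sum fun C _ => ?_
  by_cases hg : g ∉ C
  · rw [if_pos hg]
    by_cases hcC : c ∈ C
    · by_cases hjC : j ∈ C
      · have hdisj : Disjoint C {g} := disjoint_singleton_right.2 hg
        have hsub : ({c} ∆ {j} : Finset V) ⊆ C := fun v hv => by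
          rw [mem_symmDiff, mem_singleton, mem_singleton] at hv
          rcases hv with ⟨rfl, -⟩ | ⟨rfl, -⟩
          · exact hcC
          · exact hjC
        exact cmass_empty_mul_le hK hdisj hsub
      · rw [cmass_pair_eq_zero_of_not_mem K hjC, zero_mul]; exact bot_le
    · rw [cmass_eq_zero_of_not_mem_self K hcC, zero_mul]; exact bot_le
  · rw [if_neg hg, zero_mul]; exact bot_le

/-! ### The truncation bound -/

/-- **Step 1a** (switching the pair `{c,g}`; Aizenman–Duminil-Copin 2021, (3.7) with `B = {c,g}`):
`Z[A*] · Z[{c}∆{g}] = ∑_{∂n₁ = (cA)*, ∂n₂ = ∅} w w 𝟙[g ∈ C_{n₁+n₂}(c)]`. [cite: AizenmanDuminilCopinAnnals2021, §3.2, Lemma 3.3 and eq. (3.7)] -/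
theorem ecurrentSum_gstar_mul_pair (hK : ∀ e, 0 ≤ K e) {g c : V} {A : Finset V} (hc : c ∉ A) :
    ecurrentSum K (gstar g A) * ecurrentSum K ({c} ∆ {g}) =
      ∑' p : Current G × Current G, epairWeight K (gstar g (insert c A)) ∅ p *
        (if g ∈ (p.1 + p.2).cluster c then 1 else 0) := by
  have h := tsum_epairWeight_switch_pair hK (gstar g (insert c A)) c g (fun _ => 1)
  simp only [one_mul, mul_one] at h
  rw [show gstar g (insert c A) ∆ ({c} ∆ {g}) = gstar g A by
    rw [gstar_insert hc, symmDiff_symmDiff_cancel_right]] at h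
  rw [← tsum_epairWeight, h]

/-- **Step 1b**: `Z[(cA)*] · Z[∅] = ∑ w w 𝟙[g ∈ C(c)] + ∑ w w 𝟙[g ∉ C(c)]` over pairs with sources
`((cA)*, ∅)`. [folklore] -/
theorem ecurrentSum_gstar_insert_mul_empty (K : G.edgeFinset → ℝ) (g c : V) (A : Finset V) :
    ecurrentSum K (gstar g (insert c A)) * ecurrentSum K ∅ =
      (∑' p : Current G × Current G, epairWeight K (gstar g (insert c A)) ∅ p *
          (if g ∈ (p.1 + p.2).cluster c then 1 else 0)) +
        ∑' p : Current G × Current G, epairWeight K (gstar g (insert c A)) ∅ p *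
          (if g ∉ (p.1 + p.2).cluster c then 1 else 0) := by
  rw [← tsum_epairWeight, ← ENNReal.tsum_add]
  refine tsum_congr fun p => ?_
  by_cases h : g ∈ (p.1 + p.2).cluster c
  · rw [if_pos h, if_neg (not_not.2 h), mul_one, mul_zero, add_zero]
  · rw [if_neg h, if_pos h, mul_zero, mul_one, zero_add]

/-- **Step 2** (parity): in a pair with sources `((cA)*, ∅)` whose cluster of `c` avoids `g`, the cluster
of `c` contains some `j ∈ A` (it contains an even number of the sources `(cA)*`, among them `c`).
[cite: AizenmanDuminilCopinAnnals2021, §3.2 (parity of sources in a cluster)] -/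
theorem exists_mem_cluster_of_ghost_not_mem {g c : V} {A : Finset V} (hcg : c ≠ g)
    {p : Current G × Current G} (h1 : p.1.sources = gstar g (insert c A)) (h2 : p.2.sources = ∅)
    (hg : g ∉ (p.1 + p.2).cluster c) : ∃ j ∈ A, j ∈ (p.1 + p.2).cluster c := by
  classical
  set m := p.1 + p.2 with hm
  have hsrc : m.sources = gstar g (insert c A) := by
    rw [hm, sources_add, h1, h2]; exact symmDiff_bot _
  have heven := even_card_sources_filter_reachable m c
  rw [hsrc] at heven
  set F := (gstar g (insert c A)).filter fun u => (Percolation.openGraph m.traced).Reachable c u with hF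
  have hcF : c ∈ F := mem_filter.2 ⟨mem_gstar_insert_self hcg A, SimpleGraph.Reachable.refl c⟩
  -- `F` has even cardinality and contains `c`, hence another element `u`
  obtain ⟨u, huF, huc⟩ : ∃ u ∈ F, u ≠ c := by
    by_contra hcon
    push Not at hcon
    have hF1 : F = {c} := by
      refine eq_singleton_iff_unique_mem.2 ⟨hcF, fun u hu => hcon u hu⟩
    rw [hF1, card_singleton] at heven
    exact Nat.not_even_one heven
  obtain ⟨huX, hur⟩ := mem_filter.1 huF
  have hucl : u ∈ m.cluster c := mem_cluster_iff.2 hur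
  have hug : u ≠ g := fun h => hg (h ▸ hucl)
  exact ⟨u, mem_of_mem_gstar_insert huX huc hug, hucl⟩

/-- **Step 2, summed**: `∑ w w 𝟙[g ∉ C(c)] ≤ ∑_{j ∈ A} ∑ w w 𝟙[g ∉ C(c)] 𝟙[j ∈ C(c)]` (union bound
over the partner `j`). [folklore] -/
theorem tsum_notMem_le_sum {g c : V} {A : Finset V} (hcg : c ≠ g) :
    (∑' p : Current G × Current G, epairWeight K (gstar g (insert c A)) ∅ p *
        (if g ∉ (p.1 + p.2).cluster c then 1 else 0)) ≤
      ∑ j ∈ A, ∑' p : Current G × Current G, epairWeight K (gstar g (insert c A)) ∅ p *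
        ((if g ∉ (p.1 + p.2).cluster c then 1 else 0) * (if j ∈ (p.1 + p.2).cluster c then 1 else 0)) := by
  rw [← Summable.tsum_finsetSum (fun _ _ => ENNReal.summable)]
  refine ENNReal.tsum_le_tsum fun p => ?_
  by_cases hsrc : p.1.sources = gstar g (insert c A) ∧ p.2.sources = ∅
  · by_cases hg : g ∉ (p.1 + p.2).cluster c
    · obtain ⟨j, hjA, hjC⟩ := exists_mem_cluster_of_ghost_not_mem hcg hsrc.1 hsrc.2 hg
      refine le_trans ?_ (single_le_sum (f := fun j => epairWeight K (gstar g (insert c A)) ∅ p *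
        ((if g ∉ (p.1 + p.2).cluster c then 1 else 0) * (if j ∈ (p.1 + p.2).cluster c then 1 else 0)))
        (fun _ _ => bot_le) hjA)
      simp only [if_pos hg, if_pos hjC, mul_one, le_refl]
    · rw [if_neg hg, mul_zero]; exact bot_le
  · have h0 : epairWeight K (gstar g (insert c A)) ∅ p = 0 := by
      unfold epairWeight; rw [if_neg hsrc]
    simp only [h0, zero_mul, sum_const_zero, le_refl]

/-- **Step 3a** (switching the pair `{c,j}`): for `j ∈ A`,
`∑_{((cA)*,∅)} w w 𝟙[g ∉ C(c)] 𝟙[j ∈ C(c)] = ∑_{((A∖j)*, {c}∆{j})} w w 𝟙[g ∉ C_{n₁+n₂}(c)]`.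
[cite: AizenmanCMP1982, Lemma 3.2 (switching lemma)] -/
theorem tsum_notMem_mem_eq (hK : ∀ e, 0 ≤ K e) {g c j : V} {A : Finset V} (hc : c ∉ A) (hj : j ∈ A) :
    (∑' p : Current G × Current G, epairWeight K (gstar g (insert c A)) ∅ p *
        ((if g ∉ (p.1 + p.2).cluster c then 1 else 0) * (if j ∈ (p.1 + p.2).cluster c then 1 else 0))) =
      ∑' p : Current G × Current G, epairWeight K (gstar g (A.erase j)) ({c} ∆ {j}) p *
        (if g ∉ (p.1 + p.2).cluster c then 1 else 0) := by
  have h := tsum_epairWeight_switch_pair hK (gstar g (insert c A)) c j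
    (fun m => if g ∉ m.cluster c then 1 else 0)
  rw [show gstar g (insert c A) ∆ ({c} ∆ {j}) = gstar g (A.erase j) by
    rw [gstar_insert_erase hc hj, symmDiff_symmDiff_cancel_right]] at h
  exact h.symm

/-- **Step 3b** (dropping the first current): `∑_{(S, {c}∆{j})} w w 𝟙[g ∉ C_{n₁+n₂}(c)] ≤ Z[S] · G♭(c,j)`
since `C_{n₂}(c) ⊆ C_{n₁+n₂}(c)`. [folklore] -/
theorem tsum_pair_notMem_le_mul_gflat (K : G.edgeFinset → ℝ) (S : Finset V) (g c j : V) :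
    (∑' p : Current G × Current G, epairWeight K S ({c} ∆ {j}) p *
        (if g ∉ (p.1 + p.2).cluster c then 1 else 0)) ≤
      ecurrentSum K S * gflat K g c j := by
  unfold ecurrentSum gflat
  rw [tsum_mul_tsum_eq_tsum_prod]
  refine ENNReal.tsum_le_tsum fun p => ?_
  unfold epairWeight
  by_cases h1 : p.1.sources = S
  · by_cases h2 : p.2.sources = {c} ∆ {j}
    · by_cases hg : g ∉ (p.1 + p.2).cluster c
      · have hg2 : g ∉ p.2.cluster c := fun h => hg (cluster_mono (le_add_self) c h)
        rw [if_pos ⟨h1, h2⟩, if_pos hg, if_pos h1, if_pos ⟨h2, hg2⟩, mul_one]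
      · rw [if_neg hg, mul_zero]; exact bot_le
    · rw [if_neg (fun h => h2 h.2), zero_mul]; exact bot_le
  · rw [if_neg (fun h => h1 h.1), zero_mul]; exact bot_le

/-- **Steps 2–3 combined**: `N = ∑_{((cA)*,∅)} w w 𝟙[g ∉ C(c)] ≤ ∑_{j ∈ A} Z[(A∖j)*] · G♭(c,j)`.
[cite: AizenmanFernandezJSP1986, §4.3, Proposition 4.7] -/
theorem tsum_notMem_le_sum_gflat (hK : ∀ e, 0 ≤ K e) {g c : V} {A : Finset V} (hc : c ∉ A) (hcg : c ≠ g) :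
    (∑' p : Current G × Current G, epairWeight K (gstar g (insert c A)) ∅ p *
        (if g ∉ (p.1 + p.2).cluster c then 1 else 0)) ≤
      ∑ j ∈ A, ecurrentSum K (gstar g (A.erase j)) * gflat K g c j := by
  refine le_trans (tsum_notMem_le_sum hcg) (Finset.sum_le_sum fun j hj => ?_)
  rw [tsum_notMem_mem_eq hK hc hj]
  exact tsum_pair_notMem_le_mul_gflat K _ g c j

/-- **The truncation bound, product form in `ℝ≥0∞`.** For edge couplings `K ≥ 0` on a finite simple graph
with ghost `g`, `c ∉ A`, `c ≠ g` (and `Z' = ecurrentSumIn (offGraph G {g}) K`, the sums without the ghost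
edges): `Z'[∅]·(Z[(cA)*]·Z[∅]) ≤ Z'[∅]·(Z[A*]·Z[{c}∆{g}]) + Z[∅]·∑_{j∈A} Z[(A∖j)*]·Z'[{c}∆{j}]`.
[cite: AizenmanFernandezJSP1986, §4.3, Proposition 4.7, eq. (4.22)] -/
theorem ghost_truncation_bound (hK : ∀ e, 0 ≤ K e) {g c : V} {A : Finset V} (hc : c ∉ A) (hcg : c ≠ g) :
    ecurrentSumIn (offGraph G {g}) K ∅ * (ecurrentSum K (gstar g (insert c A)) * ecurrentSum K ∅) ≤
      ecurrentSumIn (offGraph G {g}) K ∅ * (ecurrentSum K (gstar g A) * ecurrentSum K ({c} ∆ {g})) +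
        ecurrentSum K ∅ * ∑ j ∈ A, ecurrentSum K (gstar g (A.erase j)) *
          ecurrentSumIn (offGraph G {g}) K ({c} ∆ {j}) := by
  set Z' := ecurrentSumIn (offGraph G {g}) K ∅ with hZ'
  rw [ecurrentSum_gstar_insert_mul_empty K g c A, ← ecurrentSum_gstar_mul_pair hK hc, mul_add]
  refine add_le_add le_rfl ?_
  calc Z' * ∑' p : Current G × Current G, epairWeight K (gstar g (insert c A)) ∅ p *
          (if g ∉ (p.1 + p.2).cluster c then 1 else 0)
      ≤ Z' * ∑ j ∈ A, ecurrentSum K (gstar g (A.erase j)) * gflat K g c j :=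
        mul_le_mul' le_rfl (tsum_notMem_le_sum_gflat hK hc hcg)
    _ = ∑ j ∈ A, ecurrentSum K (gstar g (A.erase j)) * (gflat K g c j * Z') := by
        rw [Finset.mul_sum]; exact Finset.sum_congr rfl fun j _ => by ring
    _ ≤ ∑ j ∈ A, ecurrentSum K (gstar g (A.erase j)) *
          (ecurrentSumIn (offGraph G {g}) K ({c} ∆ {j}) * ecurrentSum K ∅) :=
        Finset.sum_le_sum fun j _ => mul_le_mul' le_rfl (gflat_mul_le hK g c j)
    _ = ecurrentSum K ∅ * ∑ j ∈ A, ecurrentSum K (gstar g (A.erase j)) *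
          ecurrentSumIn (offGraph G {g}) K ({c} ∆ {j}) := by
        rw [Finset.mul_sum]; exact Finset.sum_congr rfl fun j _ => by ring

/-- **The truncation bound, ratio form.** With `W(S) = Z_K[S]/Z_K[∅]` (`= ⟨σ_S⟩` of the zero-field model on
`G`, whose ghost couplings realise a nonnegative field/`+` boundary) and `W'(S) = Z'[S]/Z'[∅]` (the model with
the ghost edges deleted, i.e. without the field), for `c ∉ A`, `c ≠ g`:
`W((cA)*) - W({c}∆{g})·W(A*) ≤ ∑_{j ∈ A} W((A∖j)*) · W'({c}∆{j})`, that is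
`⟨σ_cσ_A⟩_h - ⟨σ_c⟩_h⟨σ_A⟩_h ≤ ∑_{j∈A} ⟨σ_{A∖j}⟩_h ⟨σ_cσ_j⟩_{h=0}` (for `A = {j}`: the GHS consequence
`⟨σ_c;σ_j⟩_h ≤ ⟨σ_cσ_j⟩_{h=0}`, Aizenman–Fernández (4.22)). [cite: AizenmanFernandezJSP1986, §4.3, Proposition 4.7, eq. (4.22)] -/
theorem ghost_truncation_bound_ratio (hK : ∀ e, 0 ≤ K e) {g c : V} {A : Finset V} (hc : c ∉ A) (hcg : c ≠ g) :
    (ecurrentSum K (gstar g (insert c A))).toReal / (ecurrentSum K ∅).toReal -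
        (ecurrentSum K ({c} ∆ {g})).toReal / (ecurrentSum K ∅).toReal *
          ((ecurrentSum K (gstar g A)).toReal / (ecurrentSum K ∅).toReal) ≤
      ∑ j ∈ A, (ecurrentSum K (gstar g (A.erase j))).toReal / (ecurrentSum K ∅).toReal *
        ((ecurrentSumIn (offGraph G {g}) K ({c} ∆ {j})).toReal /
          (ecurrentSumIn (offGraph G {g}) K ∅).toReal) := by
  have hfin : ∀ S, ecurrentSum K S ≠ ∞ := fun S => ecurrentSum_ne_top hK S
  have hfin' : ∀ S, ecurrentSumIn (offGraph G {g}) K S ≠ ∞ := fun S => ecurrentSumIn_ne_top _ hK S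
  set z := (ecurrentSum K (∅ : Finset V)).toReal with hz
  set z' := (ecurrentSumIn (offGraph G {g}) K (∅ : Finset V)).toReal with hz'
  have hzpos : 0 < z := ENNReal.toReal_pos (ecurrentSum_empty_ne_zero K) (hfin ∅)
  have hz'pos : 0 < z' := ENNReal.toReal_pos (ecurrentSumIn_empty_ne_zero _ K) (hfin' ∅)
  set ZX := (ecurrentSum K (gstar g (insert c A))).toReal with hZX
  set ZA := (ecurrentSum K (gstar g A)).toReal with hZA
  set Zcg := (ecurrentSum K ({c} ∆ {g})).toReal with hZcg
  -- the product form, in `ℝ`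
  have key : z' * (ZX * z) ≤ z' * (ZA * Zcg) +
      z * ∑ j ∈ A, (ecurrentSum K (gstar g (A.erase j))).toReal *
        (ecurrentSumIn (offGraph G {g}) K ({c} ∆ {j})).toReal := by
    have h := ghost_truncation_bound hK hc hcg (g := g)
    have hL : (ecurrentSumIn (offGraph G {g}) K ∅ *
        (ecurrentSum K (gstar g (insert c A)) * ecurrentSum K ∅)).toReal = z' * (ZX * z) := by
      rw [ENNReal.toReal_mul, ENNReal.toReal_mul]
    have hsum_ne : ∑ j ∈ A, ecurrentSum K (gstar g (A.erase j)) *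
        ecurrentSumIn (offGraph G {g}) K ({c} ∆ {j}) ≠ ∞ :=
      ENNReal.sum_ne_top.2 fun j _ => ENNReal.mul_ne_top (hfin _) (hfin' _)
    have hR : (ecurrentSumIn (offGraph G {g}) K ∅ * (ecurrentSum K (gstar g A) * ecurrentSum K ({c} ∆ {g})) +
        ecurrentSum K ∅ * ∑ j ∈ A, ecurrentSum K (gstar g (A.erase j)) *
          ecurrentSumIn (offGraph G {g}) K ({c} ∆ {j})).toReal =
        z' * (ZA * Zcg) + z * ∑ j ∈ A, (ecurrentSum K (gstar g (A.erase j))).toReal *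
          (ecurrentSumIn (offGraph G {g}) K ({c} ∆ {j})).toReal := by
      rw [ENNReal.toReal_add (ENNReal.mul_ne_top (hfin' _) (ENNReal.mul_ne_top (hfin _) (hfin _)))
        (ENNReal.mul_ne_top (hfin _) hsum_ne), ENNReal.toReal_mul, ENNReal.toReal_mul, ENNReal.toReal_mul,
        ENNReal.toReal_sum (fun j _ => ENNReal.mul_ne_top (hfin _) (hfin' _))]
      congr 1
      congr 1
      exact Finset.sum_congr rfl fun j _ => ENNReal.toReal_mul
    have hmono := (ENNReal.toReal_le_toReal (ENNReal.mul_ne_top (hfin' _) (ENNReal.mul_ne_top (hfin _) (hfin _)))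
      (ENNReal.add_ne_top.2 ⟨ENNReal.mul_ne_top (hfin' _) (ENNReal.mul_ne_top (hfin _) (hfin _)),
        ENNReal.mul_ne_top (hfin _) hsum_ne⟩)).2 h
    rwa [hL, hR] at hmono
  have hzz : 0 < z * z * z' := by positivity
  calc ZX / z - Zcg / z * (ZA / z)
      = (z' * (ZX * z) - z' * (ZA * Zcg)) / (z * z * z') := by
        field_simp
    _ ≤ (z * ∑ j ∈ A, (ecurrentSum K (gstar g (A.erase j))).toReal *
          (ecurrentSumIn (offGraph G {g}) K ({c} ∆ {j})).toReal) / (z * z * z') :=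
        div_le_div_of_nonneg_right (by linarith) hzz.le
    _ = ∑ j ∈ A, (ecurrentSum K (gstar g (A.erase j))).toReal / z *
          ((ecurrentSumIn (offGraph G {g}) K ({c} ∆ {j})).toReal / z') := by
        rw [Finset.mul_sum, Finset.sum_div]
        refine Finset.sum_congr rfl fun j _ => ?_
        field_simp

end Current

end Literature.Probability.LatticeModels
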